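import Mathlib
import Summits.NavierStokesRegularity.NavierStokesRegularity.Theorems.SoloInformedIncomingNode

/-!
# No C¹ sub-Leray self-similar Euler profiles — the typed skeleton

Solo seat `solo-NavierStokesRegularity-informed` (session 10; self-contained note
`paper/no-C1-subleray-profiles.md`, CLAIMS C60–C67). Context for Clay (A): an exactly self-similar
Euler profile `u = (T-t)^{γ-1} U(x/(T-t)^γ)` can drive a Navier–Stokes singularity only for
`γ < 1/2` (then viscosity is asymptotically invisible, factor `(T-t)^{1-2γ}`). Profile equations:
`(1-γ)U + γ(y·∇)U + (U·∇)U + ∇P = 0`, `div U = 0` on `ℝ³`; `V := γ y + U`, `N_V := {V = 0}` (nodes),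
`Ω := curl U`; far field (F): `y·U(y) ≥ -(γ/2)|y|²` for `|y| ≥ R₀` (implied by `|U(y)| = o(|y|)`, the
standing class of Constantin–Ignatova–Vicol, arXiv:2602.17570, §3.1).

THEOREM 4 (hand proof in the note, NOT formalised here). `0 < γ < 1/2`, `U ∈ C¹` divergence free,
(F) ⇒ `curl U ≡ 0`; hence `U ≡ 0` if also `|U| = o(|y|)`, `U(0) = 0`. This is [CIV, Thm 3.10] with all
four extra hypotheses removed (`C²`, local outgoing property, analyticity of `Ω` at the nodes,
finiteness of `N_V`), contains [CIV, Thm 4.4/4.6] for `γ < 1/2` without axisymmetry, and closes the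
window `2/5 ≤ γ < 1/2` of Chae–Shvydkoy (ARMA 209 (2013), Thm 3.2) for sublinear `C¹` profiles.
PROOF SHAPE. (A) Cauchy formula for `C¹` profiles, `Ω(Φ_s x) = e^{-(1+γ)s} DΦ_s(x) Ω(x)` (from the
self-similar Kelvin law on infinitesimal parallelograms + Liouville `det DΦ_s = e^{3γ s}`); so
`Ω(y) ≠ 0` forces forward stretching at rate `≥ 1+γ` along the backward orbit of `y`, which by a
frozen-coefficient estimate must come from a node `y* ∈ ω(y)` with spectral abscissa
`α(∇V(y*)) ≥ 1+γ > 3γ = tr ∇V` (THEOREM 3; `expandingNode_of_cauchy_growth`). (B) The Bernoulli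
function `H = ½|V|² + P - ½γ(1-γ)|y|²`, `V·∇H = (2γ-1)|V|²`, is a strict Lyapunov function, so
backward orbits in the invariant ball accumulate on nodes only (LaSalle; `fixed_of_clusterPt_of_lyapunov`).
(D) Such "bad" nodes have a contracting direction (`badNode_hasContracting`), so the set of points
whose backward orbit is eventually trapped near them is Lebesgue-null (cone argument,
`cone_boundary_sign`), while `{Ω ≠ 0}` is open: some vortical `y` has a bad `y* ∈ ω(y)` without
converging to it, `ω(y)` is a nontrivial continuum of nodes through `y*`, `∇V(y*)` is singular and
`spec ∇V(y*) = {λ₁ ≥ 1+γ, 0, 3γ-λ₁ ≤ 2γ-1}` (`badNode_degenerate_spectrum`, `no_complexBad_with_zero`).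
(F) A `C¹` Hale–Raugel lemma (ZAMP 43 (1992); Hale, Rev. Mat. Complut. 17 (2004) Thm 6.10; Aulbach,
LNM 1058, Thm 3.1): in a gradient-like system an ω-limit point with `0` a simple eigenvalue and the
rest of the spectrum real nonzero is the whole ω-limit set — proved in the note via the saddle
integral inequality (`saddle_integral_bound`) and the centre-drift bound (`centre_drift_le`): near the
node curve a trajectory drifts along it by at most half its normal size, and every genuine excursion
costs a fixed amount of `H`. Contradiction.
WHAT IS FORMALISED: the order-theoretic core of LaSalle for the time-one map; the rate bookkeeping of
Theorem 3; the node arithmetic; the two real inequalities driving Lemma F and the sign driving Lemma D;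
and the LINE-OF-NODES MODEL (Example E of `incoming-stagnation.md` at `a₁ = -γ`, `m = 0`:
`U = (-γ y₁, (γ-1) y₂ + s y₁, y₃)`, `∇V = [[0,0,0],[s,2γ-1,0],[0,0,1+γ]]`), which realises the
degenerate bad spectrum `{1+γ, 0, 2γ-1}` on a whole line of nodes and violates (F) — showing that the
configuration excluded globally by Theorem 4 exists as a local germ (`lineOfNodes_*`).
NOT formalised: flows, line integrals, the Cauchy formula, implicit functions, null sets, continua.
[new: Theorem 4; ingredients Chae CMP 273 (2007) (transport idea), [CIV] §3.4 (Bernoulli), Hale–Raugel]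
-/

namespace Summit.NavierStokesRegularity.NavierStokesRegularity.Theorems

open Filter Topology

/-- **LaSalle core (Lemma B of the note), time-one-map form.** Let `f` be a continuous self-map, `H`
continuous with `H ≤ H ∘ f` and `H y < H (f y)` unless `f y = y`. If `H` is bounded above along the
orbit of `x`, every cluster point `z` of the orbit (limit of a subsequence of iterates) is a fixed
point. (Applied to the backward time-one map of the similarity flow on the invariant ball with the
Bernoulli function: backward limit sets consist of stagnation points.) -/
theorem fixed_of_clusterPt_of_lyapunov {X : Type*} [TopologicalSpace X] (f : X → X)
    (hf : Continuous f) (H : X → ℝ) (hH : Continuous H) (hmono : ∀ y, H y ≤ H (f y))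
    (hstrict : ∀ y, f y ≠ y → H y < H (f y)) {x z : X}
    (hbdd : BddAbove (Set.range fun n : ℕ => H (f^[n] x))) (φ : ℕ → ℕ) (hφ : StrictMono φ)
    (hz : Tendsto (fun j => f^[φ j] x) atTop (𝓝 z)) : f z = z := by
  by_contra hne
  set a : ℕ → ℝ := fun n => H (f^[n] x) with ha
  have hmono_a : Monotone a := monotone_nat_of_le_succ (fun n => by
    show H (f^[n] x) ≤ H (f^[n + 1] x)
    rw [Function.iterate_succ_apply']
    exact hmono _)
  have hconv : Tendsto a atTop (𝓝 (⨆ n, a n)) := tendsto_atTop_ciSup hmono_a hbdd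
  have h1 : Tendsto (fun j => H (f^[φ j] x)) atTop (𝓝 (H z)) := (hH.tendsto z).comp hz
  have h1' : Tendsto (fun j => H (f^[φ j] x)) atTop (𝓝 (⨆ n, a n)) :=
    hconv.comp hφ.tendsto_atTop
  have hHz : H z = ⨆ n, a n := tendsto_nhds_unique h1 h1'
  have h2 : Tendsto (fun j => H (f (f^[φ j] x))) atTop (𝓝 (H (f z))) :=
    ((hH.comp hf).tendsto z).comp hz
  have h2' : Tendsto (fun j => H (f (f^[φ j] x))) atTop (𝓝 (⨆ n, a n)) := by
    have heq : (fun j => H (f (f^[φ j] x))) = fun j => a (φ j + 1) := by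
      funext j
      show H (f (f^[φ j] x)) = H (f^[φ j + 1] x)
      rw [Function.iterate_succ_apply']
    rw [heq]
    exact hconv.comp ((tendsto_add_atTop_nat 1).comp hφ.tendsto_atTop)
  have hHfz : H (f z) = ⨆ n, a n := tendsto_nhds_unique h2 h2'
  have hlt := hstrict z hne
  linarith

/-- **Theorem 3 bookkeeping (the strongly expanding node).** Cauchy's formula gives
`|Ω(y)| e^{(1+γ)σ} ≤ M_Ω ‖DΦ_σ(Ψ_σ y)‖`, and the trajectory-wise growth lemma gives
`‖DΦ_σ(Ψ_σ y)‖ ≤ C_ε e^{(ρ+ε)σ}` with `ρ = max_{ω(y)} α(∇V)`. If `Ω(y) ≠ 0` then `1 + γ ≤ ρ`. -/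
theorem expandingNode_of_cauchy_growth {γ ρ Ω₀ M : ℝ} (hΩ : 0 < Ω₀)
    (h : ∀ ε : ℝ, 0 < ε → ∃ C : ℝ, ∀ σ : ℝ, 0 ≤ σ →
        Ω₀ * Real.exp ((1 + γ) * σ) ≤ M * C * Real.exp ((ρ + ε) * σ)) :
    1 + γ ≤ ρ := by
  by_contra hlt
  rw [not_le] at hlt
  obtain ⟨C, hC⟩ := h ((1 + γ - ρ) / 2) (by linarith)
  have := rate_le_of_exp_dominated (C := M * C) hΩ hC
  linarith

/-- Contrapositive form used in §7 of the note: if every node in the backward limit set has spectral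
abscissa `< 1+γ` (e.g. `ω(y) ∩ N_bad = ∅`), the point carries no vorticity. -/
theorem vorticity_zero_of_subcritical_growth {γ ρ Ω₀ M : ℝ} (hρ : ρ < 1 + γ) (hΩ : 0 ≤ Ω₀)
    (h : ∀ ε : ℝ, 0 < ε → ∃ C : ℝ, ∀ σ : ℝ, 0 ≤ σ →
        Ω₀ * Real.exp ((1 + γ) * σ) ≤ M * C * Real.exp ((ρ + ε) * σ)) : Ω₀ = 0 := by
  rcases hΩ.lt_or_eq with hpos | hzero
  · exact absurd (expandingNode_of_cauchy_growth hpos h) (not_le.mpr hρ)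
  · exact hzero.symm

/-- For `γ < 1/2` the Cauchy rate `1+γ` exceeds the volume rate `tr ∇V = 3γ`. -/
theorem trace_lt_cauchyRate {γ : ℝ} (hγ : γ < 1 / 2) : 3 * γ < 1 + γ := by linarith

/-- **Bad nodes have a contracting direction** (§7 Step 1): real parts `r₁ ≥ 1+γ`, `r₁+r₂+r₃ = 3γ`,
`γ < 1/2` force `r₂ + r₃ ≤ 2γ-1 < 0`, so one of them is negative (Lemma D applies). -/
theorem badNode_hasContracting {γ r₁ r₂ r₃ : ℝ} (hγ : γ < 1 / 2) (h1 : 1 + γ ≤ r₁)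
    (htr : r₁ + r₂ + r₃ = 3 * γ) : r₂ + r₃ ≤ 2 * γ - 1 ∧ min r₂ r₃ < 0 := by
  refine ⟨by linarith, ?_⟩
  rcases le_total r₂ r₃ with h | h
  · rw [min_eq_left h]; linarith
  · rw [min_eq_right h]; linarith

/-- **Lemma E(a): the degenerate bad node.** If `0` is an eigenvalue (non-isolated node) and
`r₁ ≥ 1+γ` is real, the third eigenvalue is `3γ - r₁ ≤ 2γ - 1 < 0 < r₁`: a simple zero flanked by a
strongly expanding and a contracting direction. -/
theorem badNode_degenerate_spectrum {γ r₁ r₃ : ℝ} (hγ0 : 0 < γ) (hγ : γ < 1 / 2) (h1 : 1 + γ ≤ r₁)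
    (htr : r₁ + 0 + r₃ = 3 * γ) : r₃ = 3 * γ - r₁ ∧ r₃ ≤ 2 * γ - 1 ∧ r₃ < 0 ∧ 0 < r₁ := by
  refine ⟨by linarith, by linarith, by linarith, by linarith⟩

/-- Lemma E(a), complex case excluded: a complex pair `a ± ib` together with the eigenvalue `0` has
`2a = 3γ`, hence `a < 1+γ` — such a node is never bad. -/
theorem no_complexBad_with_zero {γ a : ℝ} (hγ : γ < 2) (htr : a + a + 0 = 3 * γ) : a < 1 + γ := by
  linarith

/-- A vortical degenerate node (`Ω(y*) ≠ 0`, so `1+γ ∈ spec`, and `0 ∈ spec`) has third eigenvalue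
exactly `2γ-1`: the spectrum `{1+γ, 0, 2γ-1}` of the line-of-nodes model below. -/
theorem vortical_degenerate_node {γ r₃ : ℝ} (htr : (1 + γ) + 0 + r₃ = 3 * γ) : r₃ = 2 * γ - 1 := by
  linarith

/-- Remark 4.1 of the note: spectral sources are never bad for `γ ≤ 1/2` (each eigenvalue is
`< tr = 3γ ≤ 1+γ`), so the backward basin of the sources carries no vorticity. -/
theorem source_not_bad {γ r₁ r₂ r₃ : ℝ} (hγ : γ ≤ 1 / 2) (h₂ : 0 < r₂) (h₃ : 0 < r₃)
    (htr : r₁ + r₂ + r₃ = 3 * γ) : r₁ < 1 + γ := by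
  linarith

/-- **Lemma F, (F2): the saddle integral inequality.** With `m = min(μ₊, |μ₋|)`, `η ≤ m/4`, the
integrated differential inequalities `(m-η)∫X ≤ X(t₂) + η∫Y`, `(m-η)∫Y ≤ Y(t₁) + η∫X` give
`∫(X+Y) ≤ 2 (X(t₂) + Y(t₁)) / m`: the time-integral of the normal distance to the node curve is
controlled by the EXIT size of the unstable component and the ENTRY size of the stable one. -/
theorem saddle_integral_bound {m η IX IY X₂ Y₁ : ℝ} (hm : 0 < m) (hηm : η ≤ m / 4)
    (hIX : 0 ≤ IX) (hIY : 0 ≤ IY)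
    (hX : (m - η) * IX ≤ X₂ + η * IY) (hY : (m - η) * IY ≤ Y₁ + η * IX) :
    IX + IY ≤ 2 * (X₂ + Y₁) / m := by
  have hsum : (m - 2 * η) * (IX + IY) ≤ X₂ + Y₁ := by nlinarith
  have hhalf : (m / 2) * (IX + IY) ≤ X₂ + Y₁ := by
    have hm2 : m / 2 ≤ m - 2 * η := by linarith
    have hnn : 0 ≤ IX + IY := by linarith
    calc (m / 2) * (IX + IY) ≤ (m - 2 * η) * (IX + IY) := mul_le_mul_of_nonneg_right hm2 hnn
      _ ≤ X₂ + Y₁ := hsum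
  rw [le_div_iff₀ hm]
  nlinarith

/-- **Lemma F, (F3): the centre drift.** `|Δc| ≤ η ∫(X+Y) ≤ (2η/m)(X(t₂)+Y(t₁)) ≤ ½ (X(t₂)+Y(t₁))`:
inside a tube of normal radius `a` around an arc of nodes a trajectory moves along the arc by at
most `a` — so it cannot traverse a collar of width `2a`, and must leave through the sides. -/
theorem centre_drift_le {m η I X₂ Y₁ D : ℝ} (hm : 0 < m) (hη : 0 ≤ η) (hηm : η ≤ m / 4)
    (hpos : 0 ≤ X₂ + Y₁) (hI : I ≤ 2 * (X₂ + Y₁) / m) (hD : D ≤ η * I) :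
    D ≤ (X₂ + Y₁) / 2 := by
  have h1 : η * I ≤ η * (2 * (X₂ + Y₁) / m) := mul_le_mul_of_nonneg_left hI hη
  have hq : 0 ≤ 2 * (X₂ + Y₁) / m := div_nonneg (by linarith) hm.le
  have h2 : η * (2 * (X₂ + Y₁) / m) ≤ (m / 4) * (2 * (X₂ + Y₁) / m) :=
    mul_le_mul_of_nonneg_right hηm hq
  have h3 : (m / 4) * (2 * (X₂ + Y₁) / m) = (X₂ + Y₁) / 2 := by
    field_simp
    ring
  linarith

/-- **Lemma D, the cone sign.** In the adapted norm (`⟨L₀v,v⟩ ≥ (7β/8)|v|²` on `E^u`,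
`⟨L₀w,w⟩ ≤ (β/8)|w|²` on `E^cs`, perturbation `η = β/16`), on the boundary `|w| = |v| = v > 0` of the
cone the quantity `|w| - |v|` has derivative `≤ (β/8)v + 4ηv - (7β/8)v = -(β/2)v < 0`, and inside
the cone `|v|' ≥ (7β/8 - 2η)|v| = (3β/4)|v|`. -/
theorem cone_boundary_sign {β v : ℝ} (hβ : 0 < β) (hv : 0 < v) :
    (β / 8) * v + 4 * (β / 16) * v - (7 * β / 8) * v = -(β / 2) * v ∧ -(β / 2) * v < 0 ∧
      7 * β / 8 - 2 * (β / 16) = 3 * β / 4 := by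
  refine ⟨by ring, by nlinarith, by ring⟩

/-- **The line-of-nodes model** (Example E of `incoming-stagnation.md` at `a₁ = -γ`, `m = 0`):
`∇V = [[0,0,0],[s,2γ-1,0],[0,0,1+γ]]` has trace `3γ` … -/
theorem lineOfNodes_trace (γ s : ℝ) :
    Matrix.trace (!![0, 0, 0; s, 2 * γ - 1, 0; 0, 0, 1 + γ] : Matrix (Fin 3) (Fin 3) ℝ) = 3 * γ := by
  rw [Matrix.trace_fin_three]
  simp
  ring

/-- … the strongly expanding eigenpair `(1+γ, e₃)` (the vorticity direction: `Ω = (0,0,s)`) … -/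
theorem lineOfNodes_expanding (γ s : ℝ) :
    Matrix.mulVec (!![0, 0, 0; s, 2 * γ - 1, 0; 0, 0, 1 + γ] : Matrix (Fin 3) (Fin 3) ℝ) ![0, 0, 1]
      = (1 + γ) • ![0, 0, 1] := by
  ext i
  fin_cases i <;> simp [Matrix.mulVec, Matrix.vecHead, Matrix.vecTail]

/-- … the contracting eigenpair `(2γ-1, e₂)` … -/
theorem lineOfNodes_contracting (γ s : ℝ) :
    Matrix.mulVec (!![0, 0, 0; s, 2 * γ - 1, 0; 0, 0, 1 + γ] : Matrix (Fin 3) (Fin 3) ℝ) ![0, 1, 0]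
      = (2 * γ - 1) • ![0, 1, 0] := by
  ext i
  fin_cases i <;> simp [Matrix.mulVec, Matrix.vecHead, Matrix.vecTail]

/-- … and the kernel vector `(1-2γ, s, 0)`, tangent to the line of nodes `{s y₁ + (2γ-1) y₂ = 0 = y₃}`:
the spectrum `{1+γ, 0, 2γ-1}` of Lemma E(a) is realised on a whole line of stagnation points. -/
theorem lineOfNodes_kernel (γ s : ℝ) :
    Matrix.mulVec (!![0, 0, 0; s, 2 * γ - 1, 0; 0, 0, 1 + γ] : Matrix (Fin 3) (Fin 3) ℝ)
      ![1 - 2 * γ, s, 0] = 0 := by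
  ext i
  fin_cases i <;> simp [Matrix.mulVec, Matrix.vecHead, Matrix.vecTail]
  ring

/-- The model violates the far-field hypothesis (F): along the `y₁`-axis `y·U = -γ y₁² < -(γ/2) y₁²`
for `γ > 0`, `y₁ ≠ 0` — which is why Theorem 4 does not contradict its existence. -/
theorem lineOfNodes_violates_farField {γ y₁ : ℝ} (hγ : 0 < γ) (hy : y₁ ≠ 0) :
    -γ * y₁ ^ 2 < -(γ / 2) * y₁ ^ 2 := by
  have : 0 < y₁ ^ 2 := by positivity
  nlinarith

end Summit.NavierStokesRegularity.NavierStokesRegularity.Theorems
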